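import Summits.BirchSwinnertonDyer.BirchSwinnertonDyer.Theorems.InertBadSignedBranchesPublishedFactsInertSlim
import Summits.BirchSwinnertonDyer.BirchSwinnertonDyer.Theorems.SchneiderFreeAdditiveX3PoitouTateReciprocitySumHolds
import HarnessLib

/-!
# Route `InertBadSignedBranches` (ISB), support item `PublishedFactsInert` (stmt-BirchSwinnertonDyer-19227):
# the pack from FOUR registered children — the Poitou–Tate-with-real-places row over `ℚ` DISCHARGED

D-0154 (2) INPUTS→UNCONDITIONAL, `INPUTS-LIST-2` ADDENDUM-12 entry T15 (desk `pub/bsd-wall/bsd-inputs`; sketch by plan-2 g12, filed by seat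
`bsd-inputs-honda-p1` g6 with the real-place helper inlined). BSD is not proved by any of this.
`PublishedFactsInert` is the six-fold conjunction item-stated as the children `EntireLFunctionRat` (19273),
`GrossZagierRationalPointI73` (19369), `RankEqAnalyticRankLeOne` (19921), `PoitouTateRealRat` (19417),
`PublishedInputNewform` (19382), `PublishedInputManinOdd` (19383). Two conjuncts are now TREE THEOREMS:
conjunct 1 (entire continuation) from the newform child (`publishedFactsInert_of_slim`, p610060), and
conjunct 4 — `Literature.NumberTheory.GaloisCohomology.poitouTate_selmerStructure_duality_real ℚ`
(Poitou–Tate duality for Selmer structures with the archimedean places, Milne ADT I Thm. 4.10 (b)) — by the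
cell `bsd-schneider`'s kernel-checked
`SchneiderFreeAdditiveX3.PoitouTateReduction.poitouTate_selmerStructure_duality_real_holds` (p626891, every
number field `K`; here `K = ℚ`).

Theorems: `inertBadSignedBranches_poitouTateRealRat_of_holds` — the in-route edge (conjunct 4 as typed, from
no hypothesis); `publishedFactsInert_of_slim_real` — the pack from FOUR children (6 → 5 → 4).
HONEST FRAMING: pure glue over landed theorems; the four remaining inputs (Gross–Zagier I.(7.3), GZK,
modularity, Mazur Cor. 4.1 at odd p) stay print hypotheses and the route stays conditional on them AS TYPED;
no crux and no summit statement is proved here; nothing here proves BSD; BSD is not proved by any of this.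
-/

set_option autoImplicit false
set_option linter.dupNamespace false

namespace Summit.BirchSwinnertonDyer.BirchSwinnertonDyer.Theorems

open Literature.NumberTheory.EllipticCurves
open Summit.BirchSwinnertonDyer.BirchSwinnertonDyer.Theses.InertBadSignedBranches

/-- **`PublishedFactsInert` from FOUR of its six children, BY NAME** (route `InertBadSignedBranches`, item
stmt-BirchSwinnertonDyer-19227; INPUTS-LIST-2 ADDENDUM-12 T15): `GrossZagierRationalPointI73`,
`RankEqAnalyticRankLeOne`, `PublishedInputNewform`, `PublishedInputManinOdd` imply the six-conjunct pack —
conjunct 1 (entire continuation) by `inertBadSignedBranches_entireLFunctionRat_of_publishedInputNewform`,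
conjunct 4 (Poitou–Tate over `ℚ` with the real place) by the `bsd-schneider` cell's theorem
`SchneiderFreeAdditiveX3.PoitouTateReduction.poitouTate_selmerStructure_duality_real_holds ℚ` (p626891; the child 19417 itself is closed
by `InputsPoitouTateSelmer.inertBadSignedBranches_poitouTateRealRat_proof`, p628462).
Pure glue; the four hypotheses remain print inputs. [folklore] [cite: MilneADT2006, Ch. I, Thm. 4.10 (b)] -/
theorem publishedFactsInert_of_slim_real
    (hGZ : GrossZagierRationalPointI73) (hGZK : RankEqAnalyticRankLeOne)
    (hnf : PublishedInputNewform) (hMazur : PublishedInputManinOdd) :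
    Summit.BirchSwinnertonDyer.BirchSwinnertonDyer.Theses.InertBadSignedBranches.PublishedFactsInert :=
  publishedFactsInert_of_slim hGZ hGZK
    (SchneiderFreeAdditiveX3.PoitouTateReduction.poitouTate_selmerStructure_duality_real_holds ℚ) hnf hMazur

end Summit.BirchSwinnertonDyer.BirchSwinnertonDyer.Theorems
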